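import Literature.Computability.Cryptography.GoldreichLevinProgram
import Literature.Computability.Cryptography.GoldreichLevinTheorem
import Literature.Computability.Cryptography.OracleAdversaryShadow
import Literature.Computability.Cryptography.OracleAdversaryDecider
import Literature.Computability.Cryptography.OracleAdversaryOfFPRel
import Literature.Computability.Complexity.AdaptivePrograms
import Literature.Computability.Complexity.OracleCompositionMachine
import HarnessLib

/-!
# The Goldreich–Levin inverter run against an ORACLE distinguisher is an `FP^A` program (relativised machine layer)

Håstad–Impagliazzo–Levin–Luby (SIAM J. Comput. 28 (1999), Def. 3.6.1 and Prop. 4.1.2) and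
Allender–Buhrman–Koucký–van Melkebeek–Ronneburger (SIAM J. Comput. 35 (2006), Thm. 44) use the
Goldreich–Levin reduction RELATIVISED: the distinguisher is a probabilistic polynomial-time ORACLE
machine `M^A`, and the inverter is the oracle machine that runs the Goldreich–Levin decoder with `M^A`
as a subroutine ("the adversary enters the reduction only as a function it may call"). The tree's
machine layer (`GoldreichLevinProgram.lean`) writes the inverter `GLInv.run D q_D d e` as an `FP`-brick
program `GLProg.glRunF` around the distinguisher brick `dStr D`; this file re-reads that program with
the brick an ORACLE CALL, using the relativised brick algebra of `Complexity/AdaptivePrograms.lean`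
(`AdQuery.AdPres A h`: `h` is an adaptive `FP` program over the language oracle `A`):

* `GLProg.glRunF_adPres` — if `dStr D` is presented over `A` then so is `glRunF D q_D d e` (the
  `FP` proof `glRunF_mem_FP`, combinator by combinator: `AdPres.comp/fanout/ite/iterate`);
* `GLProg.dStr_shadow_adPres` — for a PPT oracle adversary `M` and a language `A₀`, the brick of the
  shadow distinguisher `M.shadow (ofLanguage A₀)` (`OracleAdversaryShadow.lean`) is ONE QUERY to the
  witness language `M.decLang A₀ c ∈ P^{A₀}` of `OracleAdversaryDecider.lean`; hence
  `GLProg.glRunF_shadow_mem_FPRel`: `glRunF (M.shadow A₀) M.coins d e ∈ FP^{A₀}`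
  (`FPRel_subset_FPRel_of_mem_FPRel`);
* **`GLProg.exists_ppt_glInverterO`** — the relativised Goldreich–Levin inverter as a PPT oracle
  adversary `N` (via `exists_ppt_outputPMF_of_mem_FPRel`): with the oracle `A₀`, on input `⟨1ⁿ, y⟩` its
  output law is that of `GLInv.run (M.shadow A₀) M.coins d e ⟨1ⁿ, y⟩ (r ↾ C)` for uniform coins `r`,
  where the clip `C = K_b·B + (K_b − 1)` (`B` the total length of the coin fields other than `D`'s,
  `K_b = M.coins(L_in) + 1`) makes the inverter's decoded coin count `|coins| mod K_b` EXACTLY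
  `M.coins(L_in)`, the number of coins of `M` on its queries — in the oracle model this number is
  computable, so no advice is needed (contrast `GoldreichLevinTheorem.lean`'s `clGL`).

No new definitions or named facts; the analysis (success probability per level) is the sequel
`GoldreichLevinOracle.lean`.

## References

* O. Goldreich, L. A. Levin, *A hard-core predicate for all one-way functions*, STOC 1989, §3–4.
* O. Goldreich, *Foundations of Cryptography I*, CUP 2001, Thm. 2.5.6 (proof, §2.5.3), §3.6.
* J. Håstad, R. Impagliazzo, L. A. Levin, M. Luby, *A pseudorandom generator from any one-way
  function*, SIAM J. Comput. 28 (1999) 1364–1396, Def. 3.6.1, Prop. 4.1.2.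
* E. Allender, H. Buhrman, M. Koucký, D. van Melkebeek, D. Ronneburger, *Power from random strings*,
  SIAM J. Comput. 35 (2006) 1467–1493, Thm. 44 (relativised HILL, of which relativised GL is the first step).
-/

noncomputable section

namespace Literature.Computability.Cryptography

open _root_.Computability Polynomial Complexity Complexity.Brick Complexity.Plumb Complexity.OracleCompose
  Complexity.HashBricks Complexity.PRelSigma Complexity.AdQuery CondRed GLDec GLBricks GLInv

namespace GLProg

/-! ### The program over an oracle brick -/

section Presented

variable {A : Language Bool} {D : RandAlg (List Bool) Bool} {qD : Polynomial ℕ} {d e : ℕ}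

/-- `notFn` of a presented condition is presented. [folklore] -/
theorem notFn_adPres {c : List Bool → List Bool} (hc : AdPres A c) : AdPres A (notFn c) :=
  hc.ite (AdPres.const _) (AdPres.const _)

/-- `xorFn` of presented conditions is presented. [folklore] -/
theorem xorFn_adPres {c f : List Bool → List Bool} (hc : AdPres A c) (hf : AdPres A f) : AdPres A (xorFn c f) :=
  hf.ite (notFn_adPres hc) hc

/-- **The predictor's bit is presented** when the distinguisher brick is. [cite: Goldreich2001, Thm. 2.5.6 (proof, Section 2.5.3)] -/
theorem predFB_adPres (hD : AdPres A (dStr D)) : AdPres A (predFB D) :=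
  (AdPres.of_mem_FP (comp_mem_FP headBitFn_mem_FP (cx_mem_FP 5))).ite (AdPres.of_mem_FP (comp_mem_FP headBitFn_mem_FP (cx_mem_FP 6)))
    (notFn_adPres (xorFn_adPres (AdPres.of_mem_FP (comp_mem_FP headBitFn_mem_FP (cx_mem_FP 7)))
      (xorFn_adPres (AdPres.of_mem_FP (comp_mem_FP headBitFn_mem_FP (cx_mem_FP 4))) (hD.comp_FP dInF_mem_FP))))

/-- The vote bit is presented. [folklore] -/
theorem voteB_adPres (hD : AdPres A (dStr D)) : AdPres A (voteB D) :=
  xorFn_adPres (AdPres.of_mem_FP parP_mem_FP) (predFB_adPres hD)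

/-- **The vote round body is presented.** [folklore] -/
theorem voteBody_adPres (hD : AdPres A (dStr D)) : AdPres A (voteBody D) :=
  (AdPres.of_mem_FP fstF_mem_FP).fanout ((AdPres.of_mem_FP (nthF_mem_FP 1)).fanout
    ((AdPres.of_mem_FP (comp_mem_FP (cons_mem_FP true) (nthF_mem_FP 2))).fanout
      ((voteB_adPres hD).ite (AdPres.of_mem_FP (comp_mem_FP (cons_mem_FP true) (sndPow_mem_FP 2))) (AdPres.of_mem_FP (sndPow_mem_FP 2)))))

/-- The vote loop round is presented. [folklore] -/
theorem voteRound_adPres (hD : AdPres A (dStr D)) : AdPres A (voteRound D) :=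
  (AdPres.of_mem_FP fstF_mem_FP).fanout ((voteBody_adPres hD).comp_FP sndF_mem_FP)

/-- **The vote loop is presented** (`AdPres.iterate` with the additive growth `length_voteRound_le`).
[cite: AroraBarak2009, Thm. 9.12 (proof)] -/
theorem voteLoopF_adPres (hD : AdPres A (dStr D)) : AdPres A (voteLoopF D) :=
  (AdPres.of_mem_FP (sndPow_mem_FP 3)).comp (((voteRound_adPres hD).iterate 11 length_voteRound_le X).comp
    (AdPres.of_mem_FP (fanoutFn_mem_FP (comp_mem_FP (nthF_mem_FP 2) fstF_mem_FP) (fanoutFn_mem_FP fstF_mem_FP (fanoutFn_mem_FP sndF_mem_FP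
      (fanoutFn_mem_FP (const_mem_FP _) (const_mem_FP _)))))))

/-- **The coordinate round body is presented.** [folklore] -/
theorem bitBody_adPres (hD : AdPres A (dStr D)) : AdPres A (bitBody D) := by
  have hE : eIF ∈ FP :=
    comp_mem_FP concatFn_mem_FP (fanoutFn_mem_FP (comp_mem_FP concatFn_mem_FP (fanoutFn_mem_FP
      (comp_mem_FP Kannan.zerosFn_mem_FP (nthF_mem_FP 1)) (const_mem_FP _)))
      (comp_mem_FP Kannan.zerosFn_mem_FP (comp_mem_FP dropFn_mem_FP (fanoutFn_mem_FP (comp_mem_FP (cons_mem_FP true) (nthF_mem_FP 1)) (cx_mem_FP 0)))))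
  have hC : AdPres A (cntF D) := (voteLoopF_adPres hD).comp_FP (fanoutFn_mem_FP fstF_mem_FP hE)
  have hB : AdPres A (bitF D) := (AdPres.of_mem_FP (lenLeFn_mem_FP X)).comp
    (((AdPres.of_mem_FP concatFn_mem_FP).comp (hC.fanout hC)).fanout (AdPres.of_mem_FP (comp_mem_FP (cons_mem_FP true) (cx_mem_FP 2))))
  exact (AdPres.of_mem_FP fstF_mem_FP).fanout ((AdPres.of_mem_FP (comp_mem_FP (cons_mem_FP true) (nthF_mem_FP 1))).fanout
    ((AdPres.of_mem_FP concatFn_mem_FP).comp ((AdPres.of_mem_FP (sndPow_mem_FP 1)).fanout hB)))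

/-- The coordinate loop round is presented. [folklore] -/
theorem bitRound_adPres (hD : AdPres A (dStr D)) : AdPres A (bitRound D) :=
  (AdPres.of_mem_FP fstF_mem_FP).fanout ((bitBody_adPres hD).comp_FP sndF_mem_FP)

/-- `uN ∈ FP`. [folklore] -/
theorem uN_mem_FP : uN ∈ FP := comp_mem_FP onesFn_mem_FP (comp_mem_FP fstF_mem_FP fstF_mem_FP)

/-- **The context record is an `FP` function** (the parsing half of `glRunF_mem_FP`, no oracle). [folklore] -/
theorem ctxF_mem_FP : ctxF qD d e ∈ FP := by
  have huN : uN ∈ FP := uN_mem_FP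
  have hy : yF ∈ FP := comp_mem_FP sndF_mem_FP fstF_mem_FP
  have hlg : lgU ∈ FP := comp_mem_FP logU_mem_FP huN
  have hK : KU d ∈ FP := comp_mem_FP umulFn_mem_FP (fanoutFn_mem_FP (const_mem_FP _) hlg)
  have hk : kU e ∈ FP := comp_mem_FP (cons_mem_FP true) (comp_mem_FP umulFn_mem_FP (fanoutFn_mem_FP (const_mem_FP _) (comp_mem_FP (cons_mem_FP true) hlg)))
  have htwo : twoKm1 e ∈ FP := comp_mem_FP binToUnaryFn_mem_FP (fanoutFn_mem_FP (comp_mem_FP (polyFn_mem_FP _) huN) hk)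
  have hKn : KnU d ∈ FP := comp_mem_FP umulFn_mem_FP (fanoutFn_mem_FP hK huN)
  have hkn : knU e ∈ FP := comp_mem_FP umulFn_mem_FP (fanoutFn_mem_FP hk huN)
  have hLin : LinU d ∈ FP := comp_mem_FP concatFn_mem_FP (fanoutFn_mem_FP
    (comp_mem_FP (cons_mem_FP true) (comp_mem_FP (cons_mem_FP true) (comp_mem_FP concatFn_mem_FP (fanoutFn_mem_FP huN huN))))
    (comp_mem_FP concatFn_mem_FP (fanoutFn_mem_FP (comp_mem_FP onesFn_mem_FP hy) (comp_mem_FP concatFn_mem_FP (fanoutFn_mem_FP hKn hK)))))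
  have hκ : κU qD d ∈ FP := comp_mem_FP modLenFn_mem_FP (fanoutFn_mem_FP (comp_mem_FP (cons_mem_FP true) (comp_mem_FP (polyFn_mem_FP _) hLin)) sndF_mem_FP)
  have h1 : c1 ∈ FP := comp_mem_FP dropFn_mem_FP (fanoutFn_mem_FP (const_mem_FP _) sndF_mem_FP)
  have hsgn : sgnB ∈ FP := comp_mem_FP headBitFn_mem_FP (comp_mem_FP takeFn_mem_FP (fanoutFn_mem_FP (const_mem_FP _) sndF_mem_FP))
  have hmask : maskJF d ∈ FP := CondGen.fitF_mem_FP hK (comp_mem_FP takeFn_mem_FP (fanoutFn_mem_FP hK h1))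
  have h2 : c2 d ∈ FP := comp_mem_FP dropFn_mem_FP (fanoutFn_mem_FP hK h1)
  have hβ : βB d ∈ FP := comp_mem_FP headBitFn_mem_FP (comp_mem_FP takeFn_mem_FP (fanoutFn_mem_FP (const_mem_FP _) h2))
  have h3 : c3 d ∈ FP := comp_mem_FP dropFn_mem_FP (fanoutFn_mem_FP (const_mem_FP _) h2)
  have hω : ωF d ∈ FP := CondGen.fitF_mem_FP hKn (comp_mem_FP takeFn_mem_FP (fanoutFn_mem_FP hKn h3))
  have h4 : c4 d ∈ FP := comp_mem_FP dropFn_mem_FP (fanoutFn_mem_FP hKn h3)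
  have hv : vF d ∈ FP := CondGen.fitF_mem_FP hK (comp_mem_FP takeFn_mem_FP (fanoutFn_mem_FP hK h4))
  have h5 : c5 d ∈ FP := comp_mem_FP dropFn_mem_FP (fanoutFn_mem_FP hK h4)
  have hcD : cDF qD d ∈ FP := CondGen.fitF_mem_FP hκ (comp_mem_FP takeFn_mem_FP (fanoutFn_mem_FP hκ h5))
  have h6 : c6 qD d ∈ FP := comp_mem_FP dropFn_mem_FP (fanoutFn_mem_FP hκ h5)
  have hS : SF qD d e ∈ FP := CondGen.fitF_mem_FP hkn (comp_mem_FP takeFn_mem_FP (fanoutFn_mem_FP hkn h6))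
  have h7 : c7 qD d e ∈ FP := comp_mem_FP dropFn_mem_FP (fanoutFn_mem_FP hkn h6)
  have hτ : τF qD d e ∈ FP := CondGen.fitF_mem_FP hk (comp_mem_FP takeFn_mem_FP (fanoutFn_mem_FP hk h7))
  have hj0 : j0U d ∈ FP := comp_mem_FP firstTrueFn_mem_FP hmask
  have hflag : flagB d ∈ FP := comp_mem_FP (lenLeFn_mem_FP X) (fanoutFn_mem_FP hj0 hK)
  have hj0n : j0nU d ∈ FP := comp_mem_FP umulFn_mem_FP (fanoutFn_mem_FP hj0 huN)
  have hpre : preF d ∈ FP := comp_mem_FP takeFn_mem_FP (fanoutFn_mem_FP hj0n hω)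
  have hblk : blkF d ∈ FP := comp_mem_FP takeFn_mem_FP (fanoutFn_mem_FP huN (comp_mem_FP dropFn_mem_FP (fanoutFn_mem_FP hj0n hω)))
  have hpost : postF d ∈ FP := comp_mem_FP dropFn_mem_FP (fanoutFn_mem_FP (comp_mem_FP umulFn_mem_FP (fanoutFn_mem_FP
    (comp_mem_FP (cons_mem_FP true) hj0) huN)) hω)
  have hM : MF d ∈ FP := comp_mem_FP mxFn_mem_FP (fanoutFn_mem_FP (fanoutFn_mem_FP huN hK) (fanoutFn_mem_FP hmask hω))
  have hpar : parJV d ∈ FP := comp_mem_FP andParityFn_mem_FP (fanoutFn_mem_FP hmask hv)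
  exact fanoutFn_mem_FP huN (fanoutFn_mem_FP hk (fanoutFn_mem_FP htwo (fanoutFn_mem_FP hy (fanoutFn_mem_FP hsgn (fanoutFn_mem_FP hflag
    (fanoutFn_mem_FP hβ (fanoutFn_mem_FP hpar (fanoutFn_mem_FP hpre (fanoutFn_mem_FP hM (fanoutFn_mem_FP hblk (fanoutFn_mem_FP hpost
      (fanoutFn_mem_FP hv (fanoutFn_mem_FP hcD (fanoutFn_mem_FP hS hτ))))))))))))))

/-- **The run function of `𝒜_GL` is an adaptive `FP` program over `A`** when the distinguisher brick
is (the `FP` proof `glRunF_mem_FP` with the oracle brick). [cite: Goldreich2001, Thm. 2.5.6 (proof, Section 2.5.3)] -/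
theorem glRunF_adPres (hD : AdPres A (dStr D)) : AdPres A (glRunF D qD d e) :=
  (AdPres.of_mem_FP (sndPow_mem_FP 2)).comp (((bitRound_adPres hD).iterate 9 length_bitRound_le X).comp
    (AdPres.of_mem_FP (fanoutFn_mem_FP uN_mem_FP (fanoutFn_mem_FP ctxF_mem_FP (fanoutFn_mem_FP (const_mem_FP _) (const_mem_FP _))))))

end Presented

/-! ### The shadow distinguisher's brick is one query to the witness language -/

section Shadow

variable (M : OracleAdversary Bool)

/-- **`dStr` of the shadow is the oracle call** `z ↦ [⟨z.1, z.2⟩ ∈ L']` to the witness language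
`L' = M.decLang A₀ c`, for any cap `c` on the queries of `M` (`boolPair_mem_decLang_iff`).
[cite: AroraBarakCC2009, Def. 7.1 with §3.4] -/
theorem dStr_shadow_eq (A₀ : Language Bool) {c : Polynomial ℕ}
    (hc : ∀ (w : List Bool) (n : ℕ), n ≤ M.fuel.eval w.length →
      ∀ y ∈ M.alg.queries (Oracle.ofLanguage A₀) n w, y.length ≤ c.eval w.length) :
    dStr (M.shadow (Oracle.ofLanguage A₀)) = fun z => [(M.decLang A₀ c).boolIndicator (fanoutFn fstF sndF z)] := by
  funext z
  rw [fanoutFn_apply]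
  have henc : ∀ b : Bool, encodeBool b = [b] := fun b => by cases b <;> rfl
  have hrun : dStr (M.shadow (Oracle.ofLanguage A₀)) z =
      [decide (M.alg.run (Oracle.ofLanguage A₀) (M.fuel.eval (fstF z).length) (boolPair (fstF z) (sndF z)) = some true)] := by
    simp only [dStr, Function.comp_apply, OracleAdversary.shadow_run, henc]
    rfl
  rw [hrun]
  by_cases h : M.alg.run (Oracle.ofLanguage A₀) (M.fuel.eval (fstF z).length) (boolPair (fstF z) (sndF z)) = some true
  · rw [decide_eq_true h, (Set.mem_iff_boolIndicator _ _).1 ((M.boolPair_mem_decLang_iff A₀ hc _ _).2 h)]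
  · rw [decide_eq_false h, (Set.notMem_iff_boolIndicator _ _).1 (fun h' => h ((M.boolPair_mem_decLang_iff A₀ hc _ _).1 h'))]

/-- **The shadow's brick is presented over the witness language.** [cite: AroraBarakCC2009, Def. 7.1 with §3.4] -/
theorem dStr_shadow_adPres (A₀ : Language Bool) {c : Polynomial ℕ}
    (hc : ∀ (w : List Bool) (n : ℕ), n ≤ M.fuel.eval w.length →
      ∀ y ∈ M.alg.queries (Oracle.ofLanguage A₀) n w, y.length ≤ c.eval w.length) :
    AdPres (M.decLang A₀ c) (dStr (M.shadow (Oracle.ofLanguage A₀))) := by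
  rw [dStr_shadow_eq M A₀ hc]
  exact AdPres.query (fanoutFn_mem_FP fstF_mem_FP sndF_mem_FP)

/-- **The Goldreich–Levin program around a PPT oracle distinguisher is in `FP^{A₀}`**: presented over
the witness language `L' ∈ P^{A₀}` (`decLang_mem_PRel`), hence in `FP^{L'} ⊆ FP^{A₀}`
(`FPRel_subset_FPRel_of_mem_FPRel`). [cite: HastadImpagliazzoLevinLuby1999, Def. 3.6.1 with Prop. 4.1.2] -/
theorem glRunF_shadow_mem_FPRel (hM : M.IsPPT encodingBoolBool) (A₀ : Language Bool) (d e : ℕ) :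
    glRunF (M.shadow (Oracle.ofLanguage A₀)) M.coins d e ∈ FPRel (Oracle.ofLanguage A₀) := by
  obtain ⟨c, hc⟩ := OracleAdversary.exists_cap (M := M.alg) hM M.fuel
  have h := (glRunF_adPres (qD := M.coins) (d := d) (e := e) (dStr_shadow_adPres M A₀ (hc A₀))).mem_FPRel
  exact OracleAlg.FPRel_subset_FPRel_of_mem_FPRel (OracleAlg.ofLanguage_mem_FPRel_of_mem_PRel (M.decLang_mem_PRel hM A₀ c)) h

/-- **The Goldreich–Levin program around ANY distinguisher brick presented over a language `L ∈ P^{A₀}` is in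
`FP^{A₀}`** (the generic form used by reductions that build their distinguisher as an adaptive program).
[cite: HastadImpagliazzoLevinLuby1999, Def. 3.6.1 with Prop. 4.1.2] -/
theorem glRunF_mem_FPRel_of_adPres {D : RandAlg (List Bool) Bool} (qD : Polynomial ℕ) (d e : ℕ) {L A₀ : Language Bool}
    (hL : L ∈ PRel (Oracle.ofLanguage A₀)) (hD : AdPres L (dStr D)) :
    glRunF D qD d e ∈ FPRel (Oracle.ofLanguage A₀) :=
  OracleAlg.FPRel_subset_FPRel_of_mem_FPRel (OracleAlg.ofLanguage_mem_FPRel_of_mem_PRel hL)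
    (glRunF_adPres (qD := qD) (d := d) (e := e) hD).mem_FPRel

end Shadow

/-! ### The relativised inverter: clipped coins and the PPT oracle adversary -/

section Inverter

variable (M : OracleAdversary Bool) (d e : ℕ)

/-- `kof e n ≤ (2e+1)(n+1) + 1`. [folklore] -/
theorem kof_le' (e n : ℕ) : kof e n ≤ (2 * e + 1) * (n + 1) + 1 := by
  unfold kof
  have := Nat.log_le_self 2 n
  exact Nat.add_le_add_right (Nat.mul_le_mul_left _ (by omega)) 1

/-- **The coin clip is polynomially bounded**: with `n, ℓ ≤ L = |⟨1ⁿ, y⟩|`,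
`K_b·B + (K_b − 1) ≤ P(L)` for the explicit polynomial `P` of the statement. [folklore] -/
theorem clip_le (qD : Polynomial ℕ) (inp : List Bool) :
    Kb qD d (nOf inp) (yOf inp).length * (2 + Kof d (nOf inp) + Kof d (nOf inp) * nOf inp + Kof d (nOf inp) + kof e (nOf inp) * nOf inp + kof e (nOf inp)) +
        (Kb qD d (nOf inp) (yOf inp).length - 1) ≤
      ((qD.comp (C d * X ^ 2 + C (d + 3) * X + 2) + 1) * (C d * X ^ 2 + C (2 * d) * X + 2 + (C (2 * e + 1) * (X + 1) + 1) * (X + 1)) +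
        qD.comp (C d * X ^ 2 + C (d + 3) * X + 2)).eval inp.length := by
  set L := inp.length with hL
  set n := nOf inp with hn
  have hnL : n ≤ L := length_boolUnpair_fst_le inp
  have hℓL : (yOf inp).length ≤ L := by
    have := length_fstF_sndF_le inp
    change 2 * (boolUnpair inp).1.length + (boolUnpair inp).2.length ≤ _ at this
    unfold yOf; omega
  have hK := GLInv.Kof_le d n
  have hk := kof_le' e n
  have hLin : Lin d n (yOf inp).length ≤ (C d * X ^ 2 + C (d + 3) * X + 2 : Polynomial ℕ).eval L := by
    simp only [Lin, eval_add, eval_mul, eval_C, eval_pow, eval_X, eval_ofNat]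
    have h1 : Kof d n * n ≤ d * L * L := Nat.mul_le_mul (hK.trans (Nat.mul_le_mul_left d hnL)) hnL
    have h2 : Kof d n ≤ d * L := hK.trans (Nat.mul_le_mul_left d hnL)
    nlinarith
  have hKb : Kb qD d n (yOf inp).length ≤ (qD.comp (C d * X ^ 2 + C (d + 3) * X + 2) + 1 : Polynomial ℕ).eval L := by
    unfold Kb
    rw [eval_add, eval_one, eval_comp]
    exact Nat.add_le_add_right (TM2Iter.eval_mono qD hLin) 1
  have hB : 2 + Kof d n + Kof d n * n + Kof d n + kof e n * n + kof e n ≤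
      (C d * X ^ 2 + C (2 * d) * X + 2 + (C (2 * e + 1) * (X + 1) + 1) * (X + 1) : Polynomial ℕ).eval L := by
    simp only [eval_add, eval_mul, eval_C, eval_pow, eval_X, eval_ofNat, eval_one]
    have h1 : Kof d n * n ≤ d * L * L := Nat.mul_le_mul (hK.trans (Nat.mul_le_mul_left d hnL)) hnL
    have h2 : Kof d n ≤ d * L := hK.trans (Nat.mul_le_mul_left d hnL)
    have h3 : kof e n ≤ (2 * e + 1) * (L + 1) + 1 := hk.trans (by nlinarith)
    have h4 : kof e n * n ≤ ((2 * e + 1) * (L + 1) + 1) * L := Nat.mul_le_mul h3 hnL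
    nlinarith
  have hKb1 : Kb qD d n (yOf inp).length - 1 ≤ (qD.comp (C d * X ^ 2 + C (d + 3) * X + 2) : Polynomial ℕ).eval L := by
    unfold Kb
    rw [Nat.add_sub_cancel, eval_comp]
    exact TM2Iter.eval_mono qD hLin
  rw [eval_add, eval_mul]
  exact Nat.add_le_add (Nat.mul_le_mul hKb hB) hKb1

/-- **The relativised Goldreich–Levin inverter as a PPT oracle adversary, generic form.** For ANY
`RandAlg` distinguisher `D` whose brick `dStr D` is an adaptive `FP` program over a language
`L ∈ P^{A₀}`, a coin polynomial `q_D` and parameters `d, e`, there is a PPT oracle adversary `N` such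
that, with the oracle `A₀`, the output law of `N` on every input `inp = ⟨1ⁿ, y⟩` is the law of
`GLInv.run D q_D d e inp (r ↾ C)` over its uniform coins `r` (`|r| ≥ C`), with the clip
`C = K_b·B + (K_b − 1)` so that the decoded coin count is `C mod K_b = K_b − 1 = q_D(L_in)`.
[cite: Goldreich2001, Thm. 2.5.6 (proof, Section 2.5.3) with §3.6 Def. 3.6.4]
[cite: HastadImpagliazzoLevinLuby1999, Def. 3.6.1 with Prop. 4.1.2] -/
theorem exists_ppt_glInverterO_of_adPres {D : RandAlg (List Bool) Bool} (qD : Polynomial ℕ) {L A₀ : Language Bool}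
    (hL : L ∈ PRel (Oracle.ofLanguage A₀)) (hD : AdPres L (dStr D)) :
    ∃ (N : OracleAdversary (List Bool)) (P : Polynomial ℕ), N.IsPPT (encodingList Bool) ∧ N.coins = P ∧
      (∀ inp : List Bool,
        Kb qD d (nOf inp) (yOf inp).length *
              (2 + Kof d (nOf inp) + Kof d (nOf inp) * nOf inp + Kof d (nOf inp) + kof e (nOf inp) * nOf inp + kof e (nOf inp)) +
            (Kb qD d (nOf inp) (yOf inp).length - 1) ≤ P.eval inp.length) ∧
      ∀ inp : List Bool, N.outputPMF (Oracle.ofLanguage A₀) inp =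
        (PMF.uniformOfFintype (List.Vector Bool (P.eval inp.length))).map fun r =>
          some (GLInv.run D qD d e inp
            (r.toList.take (Kb qD d (nOf inp) (yOf inp).length *
                (2 + Kof d (nOf inp) + Kof d (nOf inp) * nOf inp + Kof d (nOf inp) + kof e (nOf inp) * nOf inp + kof e (nOf inp)) +
              (Kb qD d (nOf inp) (yOf inp).length - 1)))) := by
  -- the clip in unary: `K_b`, `B = 2 + K + Kn + K + kn + k`, `K_b − 1 = q_D(L_in)`
  set BU : List Bool → List Bool := concatFn ∘ fanoutFn (fun _ => ones 2) (concatFn ∘ fanoutFn (KU d) (concatFn ∘ fanoutFn (KnU d)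
    (concatFn ∘ fanoutFn (KU d) (concatFn ∘ fanoutFn (knU e) (kU e))))) with hBU
  set CU : List Bool → List Bool := concatFn ∘ fanoutFn (umulFn ∘ fanoutFn (KbU qD d) BU) (polyFn qD ∘ LinU d) with hCU
  have hlg : lgU ∈ FP := comp_mem_FP logU_mem_FP uN_mem_FP
  have hK : KU d ∈ FP := comp_mem_FP umulFn_mem_FP (fanoutFn_mem_FP (const_mem_FP _) hlg)
  have hk : kU e ∈ FP := comp_mem_FP (cons_mem_FP true) (comp_mem_FP umulFn_mem_FP (fanoutFn_mem_FP (const_mem_FP _) (comp_mem_FP (cons_mem_FP true) hlg)))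
  have hKn : KnU d ∈ FP := comp_mem_FP umulFn_mem_FP (fanoutFn_mem_FP hK uN_mem_FP)
  have hkn : knU e ∈ FP := comp_mem_FP umulFn_mem_FP (fanoutFn_mem_FP hk uN_mem_FP)
  have hLin : LinU d ∈ FP := comp_mem_FP concatFn_mem_FP (fanoutFn_mem_FP
    (comp_mem_FP (cons_mem_FP true) (comp_mem_FP (cons_mem_FP true) (comp_mem_FP concatFn_mem_FP (fanoutFn_mem_FP uN_mem_FP uN_mem_FP))))
    (comp_mem_FP concatFn_mem_FP (fanoutFn_mem_FP (comp_mem_FP onesFn_mem_FP (comp_mem_FP sndF_mem_FP fstF_mem_FP))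
      (comp_mem_FP concatFn_mem_FP (fanoutFn_mem_FP hKn hK)))))
  have hKbm : KbU qD d ∈ FP := comp_mem_FP (cons_mem_FP true) (comp_mem_FP (polyFn_mem_FP _) hLin)
  have hBUm : BU ∈ FP := comp_mem_FP concatFn_mem_FP (fanoutFn_mem_FP (const_mem_FP _) (comp_mem_FP concatFn_mem_FP (fanoutFn_mem_FP hK
    (comp_mem_FP concatFn_mem_FP (fanoutFn_mem_FP hKn (comp_mem_FP concatFn_mem_FP (fanoutFn_mem_FP hK (comp_mem_FP concatFn_mem_FP (fanoutFn_mem_FP hkn hk)))))))))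
  have hCUm : CU ∈ FP := comp_mem_FP concatFn_mem_FP (fanoutFn_mem_FP (comp_mem_FP umulFn_mem_FP (fanoutFn_mem_FP hKbm hBUm))
    (comp_mem_FP (polyFn_mem_FP _) hLin))
  -- its value
  have hCU_apply : ∀ inp r : List Bool, CU (boolPair inp r) =
      ones (Kb qD d (nOf inp) (yOf inp).length *
          (2 + Kof d (nOf inp) + Kof d (nOf inp) * nOf inp + Kof d (nOf inp) + kof e (nOf inp) * nOf inp + kof e (nOf inp)) +
        (Kb qD d (nOf inp) (yOf inp).length - 1)) := by
    intro inp r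
    have hB : BU (boolPair inp r) = ones (2 + Kof d (nOf inp) + Kof d (nOf inp) * nOf inp + Kof d (nOf inp) + kof e (nOf inp) * nOf inp + kof e (nOf inp)) := by
      rw [hBU]
      simp only [Function.comp_apply, fanoutFn_apply, KU_apply, KnU_apply, knU_apply, kU_apply, concatFn_boolPair, Com.ones_append]
      congr 1; ring
    have hKb : KbU qD d (boolPair inp r) = ones (Kb qD d (nOf inp) (yOf inp).length) := by
      simp only [KbU, Function.comp_apply, LinU_apply, polyFn_apply, List.length_replicate, true_cons_ones, Kb]
    rw [hCU]
    simp only [Function.comp_apply, fanoutFn_apply, hB, hKb, umulFn_boolPair, LinU_apply, polyFn_apply, List.length_replicate,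
      concatFn_boolPair, Com.ones_append, Kb, Nat.add_sub_cancel]
  -- the clipped-coin preprocessing and the inverter's run function on `⟨inp, r⟩`
  set pre : List Bool → List Bool := fanoutFn fstF (takeFn ∘ fanoutFn CU sndF) with hpre
  have hprem : pre ∈ FP := fanoutFn_mem_FP fstF_mem_FP (comp_mem_FP takeFn_mem_FP (fanoutFn_mem_FP hCUm sndF_mem_FP))
  have hH : glRunF D qD d e ∘ pre ∈ FPRel (Oracle.ofLanguage A₀) :=
    comp_FP_mem_FPRel (glRunF_mem_FPRel_of_adPres qD d e hL hD) hprem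
  obtain ⟨N, hN, hcoins, hlaw⟩ := exists_ppt_outputPMF_of_mem_FPRel hH
    ((qD.comp (C d * X ^ 2 + C (d + 3) * X + 2) + 1) * (C d * X ^ 2 + C (2 * d) * X + 2 + (C (2 * e + 1) * (X + 1) + 1) * (X + 1)) +
      qD.comp (C d * X ^ 2 + C (d + 3) * X + 2))
  refine ⟨N, _, hN, hcoins, fun inp => clip_le d e qD inp, fun inp => ?_⟩
  · rw [hlaw inp]
    refine congrArg (fun f => PMF.map f _) (funext fun r => ?_)
    rw [Function.comp_apply, hpre, fanoutFn_apply, fstF_boolPair, Function.comp_apply, fanoutFn_apply, sndF_boolPair, hCU_apply,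
      takeFn_boolPair, List.length_replicate, glRunF_boolPair]

/-- **The relativised Goldreich–Levin inverter as a PPT oracle adversary.** For a PPT oracle
distinguisher `M`, parameters `d, e` and a language `A₀` there is a PPT oracle adversary `N` such
that, with the oracle `A₀`, the output law of `N` on every input `inp = ⟨1ⁿ, y⟩` is the law of
`GLInv.run (M.shadow A₀) M.coins d e inp (r ↾ C)` over its uniform coins `r` (`|r| ≥ C`), with the
clip `C = K_b·B + (K_b − 1)` so that the decoded coin count is `C mod K_b = K_b − 1 = M.coins(L_in)`
(the shadow's brick is one query to the witness language `M.decLang A₀ c ∈ P^{A₀}`).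
[cite: Goldreich2001, Thm. 2.5.6 (proof, Section 2.5.3) with §3.6 Def. 3.6.4]
[cite: HastadImpagliazzoLevinLuby1999, Def. 3.6.1 with Prop. 4.1.2] -/
theorem exists_ppt_glInverterO (hM : M.IsPPT encodingBoolBool) (A₀ : Language Bool) :
    ∃ (N : OracleAdversary (List Bool)) (P : Polynomial ℕ), N.IsPPT (encodingList Bool) ∧ N.coins = P ∧
      (∀ inp : List Bool,
        Kb M.coins d (nOf inp) (yOf inp).length *
              (2 + Kof d (nOf inp) + Kof d (nOf inp) * nOf inp + Kof d (nOf inp) + kof e (nOf inp) * nOf inp + kof e (nOf inp)) +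
            (Kb M.coins d (nOf inp) (yOf inp).length - 1) ≤ P.eval inp.length) ∧
      ∀ inp : List Bool, N.outputPMF (Oracle.ofLanguage A₀) inp =
        (PMF.uniformOfFintype (List.Vector Bool (P.eval inp.length))).map fun r =>
          some (GLInv.run (M.shadow (Oracle.ofLanguage A₀)) M.coins d e inp
            (r.toList.take (Kb M.coins d (nOf inp) (yOf inp).length *
                (2 + Kof d (nOf inp) + Kof d (nOf inp) * nOf inp + Kof d (nOf inp) + kof e (nOf inp) * nOf inp + kof e (nOf inp)) +
              (Kb M.coins d (nOf inp) (yOf inp).length - 1)))) := by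
  obtain ⟨c, hc⟩ := OracleAdversary.exists_cap (M := M.alg) hM M.fuel
  exact exists_ppt_glInverterO_of_adPres d e M.coins (M.decLang_mem_PRel hM A₀ c) (dStr_shadow_adPres M A₀ (hc A₀))

end Inverter

end GLProg

end Literature.Computability.Cryptography

end
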